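import Summits.Ventures.PercRepro.PuncturedLYMTwoCoHypSeq

/-!
# PercRepro — TWO DISJOINT CO-HYPERPLANES, PART 5: THE DEFICIT FORM OF THE ONE-CO-HYPERPLANE FLOW (p10, gen 35)

Arithmetic only.  In units of the free flow `1/(n − j)` the gen-33 one-co-hyperplane flow at a row of level `c`
(`c = #(X ∩ C)`) is `1 − f_c` on the edges leaving `C` and `1 + g_c` on the edges into `C`:
`f_c = 1 − (n − j)·xv c` (`coF`, the R-DEFICIT) and `g_c = (n − j)·yv c − 1` (`coG`, the A-SURPLUS), with
`δ = C(n − m, j − m)/C(n, j)` (`coDel`, the probability that a `j`-set contains `C`).  The five identities of gen 33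
become: `(m − c)·g_c = (n − j − m + c)·f_c` (`coF_row`), `c'·g_{c'−1} + (j + 1)·δ = (j + 1 − c')·f_{c'}` (`coF_col`),
`f_0 = δ` (`coF_zero`), `m·(1 + g_{m−1}) = (j + 1)(1 − δ)` (`coF_top`); the exact solution reads
`f_c = δ + V_c·Q_c/(C(m, c)·C(n, j))` (`coF_eq`).  BOUNDS: `0 ≤ f_c ≤ 1`, `g_c ≥ 0`; `δ·2^m ≤ 1`
(`coDel_mul_two_pow_le`); `f_{m−1} ≤ (j + 1 − m)/(m·(n − j − 1))` (`coF_top_le`); `f_c ≤ δ + 1/C(m, c)`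
(`coF_le_coDel_add`); and **`f_c ≤ 1/2`** for every `c < m` when `2 ≤ m` (`coF_le_half`).
These feed the explicit two-co-hyperplane flow of part 6.  Nothing here asserts (SP), (PAV) or (NC).
-/

namespace PercRepro.PuncturedLYM

open Finset

/-- `f_c = 1 − (n − j)·xv c`: the R-deficit of the one-co-hyperplane flow at level `c`, in units of the free flow. -/
def coF (n j m c : ℕ) : ℚ := 1 - ((n - j : ℕ) : ℚ) * coXv n j m c

/-- `g_c = (n − j)·yv c − 1`: the A-surplus. -/
def coG (n j m c : ℕ) : ℚ := ((n - j : ℕ) : ℚ) * coYv n j m c - 1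

/-- `δ = C(n − m, j − m)/C(n, j)`. -/
def coDel (n j m : ℕ) : ℚ := ((n - m).choose (j - m) : ℕ) / (n.choose j : ℕ)

/-- `C(m, c) ≥ m` for `1 ≤ c < m`. -/
theorem le_choose_of_one_le_of_lt {m c : ℕ} (h1 : 1 ≤ c) (hc : c < m) : m ≤ m.choose c := by
  induction m generalizing c with
  | zero => omega
  | succ m ih =>
    rcases Nat.eq_or_lt_of_le h1 with h | h2
    · subst h
      rw [Nat.choose_one_right]
    · rcases Nat.eq_or_lt_of_le (Nat.le_of_lt_succ hc) with h | h3
      · subst h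
        rw [Nat.choose_succ_self_right]
      · obtain ⟨c', rfl⟩ : ∃ c', c = c' + 1 := ⟨c - 1, by omega⟩
        rw [Nat.choose_succ_succ']
        have i1 := ih (c := c') (by omega) (by omega)
        have i2 := ih (c := c' + 1) (by omega) h3
        omega

/-- `(j + 1)·C(n, j + 1) = (n − j)·C(n, j)` in `ℚ`. -/
theorem choose_succ_mul_eq (n j : ℕ) :
    ((j : ℚ) + 1) * ((n.choose (j + 1) : ℕ) : ℚ) = ((n - j : ℕ) : ℚ) * ((n.choose j : ℕ) : ℚ) := by
  have h := Nat.choose_succ_right_eq n j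
  have hq : ((n.choose (j + 1) * (j + 1) : ℕ) : ℚ) = ((n.choose j * (n - j) : ℕ) : ℚ) := by rw [h]
  push_cast at hq
  linarith

/-- `(n − j)·k = (j + 1)·(1 − δ)`. -/
theorem coK_mul_r {n j m : ℕ} (hn : 2 * j + 1 ≤ n) :
    ((n - j : ℕ) : ℚ) * coK n j m = ((j : ℚ) + 1) * (1 - coDel n j m) := by
  have hC : (0 : ℚ) < ((n.choose j : ℕ) : ℚ) := by exact_mod_cast Nat.choose_pos (by omega)
  have hC1 : (0 : ℚ) < ((n.choose (j + 1) : ℕ) : ℚ) := by exact_mod_cast Nat.choose_pos (by omega)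
  have h := choose_succ_mul_eq n j
  unfold coK coDel coP
  field_simp
  linear_combination (-(((n.choose j : ℕ) : ℚ) - ((n - m).choose (j - m) : ℕ))) * h

/-- `δ ≥ 0`. -/
theorem coDel_nonneg (n j m : ℕ) : 0 ≤ coDel n j m := by
  unfold coDel
  positivity

/-- `1 − δ = #P/C(n, j)`. -/
theorem one_sub_coDel {n j m : ℕ} (hn : 2 * j + 1 ≤ n) :
    1 - coDel n j m = coP n j m / ((n.choose j : ℕ) : ℚ) := by
  have hC : (0 : ℚ) < ((n.choose j : ℕ) : ℚ) := by exact_mod_cast Nat.choose_pos (by omega)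
  unfold coDel coP
  field_simp

/-- **The exact solution in deficit form**: `f_c = δ + V_c·Q_c/(C(m, c)·C(n, j))` for `c ≤ m`. -/
theorem coF_eq {n j m c : ℕ} (hm : 1 ≤ m) (hmj : m ≤ j) (hn : 2 * j + 1 ≤ n) (hc : c ≤ m) :
    coF n j m c = coDel n j m + coV n j m c * coQ n j m c / (((m.choose c : ℕ) : ℚ) * ((n.choose j : ℕ) : ℚ)) := by
  have hP := coP_pos hm hmj hn
  have hC : (0 : ℚ) < ((n.choose j : ℕ) : ℚ) := by exact_mod_cast Nat.choose_pos (by omega)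
  have hB : (0 : ℚ) < ((m.choose c : ℕ) : ℚ) := by exact_mod_cast Nat.choose_pos hc
  have hj : (0 : ℚ) < (j : ℚ) + 1 := by positivity
  have hk := coK_mul_r (m := m) hn
  have h1 := one_sub_coDel (m := m) hn
  have hδ : coDel n j m = 1 - coP n j m / ((n.choose j : ℕ) : ℚ) := by linarith
  unfold coF coXv coXi
  have e : ((n - j : ℕ) : ℚ) * (coK n j m / ((j : ℚ) + 1) * (1 - coV n j m c * coQ n j m c / ((m.choose c : ℕ) * coP n j m))) =
      (((n - j : ℕ) : ℚ) * coK n j m) / ((j : ℚ) + 1) *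
        (1 - coV n j m c * coQ n j m c / ((m.choose c : ℕ) * coP n j m)) := by ring
  rw [e, hk, hδ]
  field_simp
  ring

/-- The row identity in deficit form: `(m − c)·g_c = (n − j − m + c)·f_c` for `c < m`. -/
theorem coF_row {n j m c : ℕ} (hm : 1 ≤ m) (hmj : m ≤ j) (hn : 2 * j + 1 ≤ n) (hc : c < m) :
    ((m : ℚ) - c) * coG n j m c = ((n : ℚ) - j - m + c) * coF n j m c := by
  have h := coSeq_row hm hmj hn hc
  have hnj : ((n - j : ℕ) : ℚ) = (n : ℚ) - j := by rw [Nat.cast_sub (by omega)]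
  unfold coG coF
  rw [hnj]
  linear_combination ((n : ℚ) - j) * h

/-- The column identity in deficit form: `c'·g_{c'−1} + (j + 1)·δ = (j + 1 − c')·f_{c'}` for `1 ≤ c' < m`. -/
theorem coF_col {n j m c' : ℕ} (hm : 1 ≤ m) (hmj : m ≤ j) (hn : 2 * j + 1 ≤ n) (hc1 : 1 ≤ c') (hc : c' < m) :
    (c' : ℚ) * coG n j m (c' - 1) + ((j : ℚ) + 1) * coDel n j m = ((j : ℚ) + 1 - c') * coF n j m c' := by
  have h := coSeq_col hm hmj hn hc1 hc
  have hk := coK_mul_r (m := m) hn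
  unfold coG coF
  linear_combination ((n - j : ℕ) : ℚ) * h + hk

/-- `f_0 = δ`. -/
theorem coF_zero {n j m : ℕ} (hn : 2 * j + 1 ≤ n) : coF n j m 0 = coDel n j m := by
  have h := coSeq_col0 n j m
  have hk := coK_mul_r (m := m) hn
  have hj : (0 : ℚ) < (j : ℚ) + 1 := by positivity
  unfold coF
  have e : ((n - j : ℕ) : ℚ) * coXv n j m 0 = (((j : ℚ) + 1) * coXv n j m 0) * ((n - j : ℕ) : ℚ) / ((j : ℚ) + 1) := by
    field_simp
  rw [e, h, mul_comm, hk]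
  field_simp
  ring

/-- The top identity in deficit form: `m·(1 + g_{m−1}) = (j + 1)·(1 − δ)`. -/
theorem coF_top {n j m : ℕ} (hm : 1 ≤ m) (hmj : m ≤ j) (hn : 2 * j + 1 ≤ n) :
    (m : ℚ) * (1 + coG n j m (m - 1)) = ((j : ℚ) + 1) * (1 - coDel n j m) := by
  have h := coSeq_top hm hmj hn
  have hk := coK_mul_r (m := m) hn
  unfold coG
  linear_combination ((n - j : ℕ) : ℚ) * h + hk

/-- `f_c ≥ 0` for `c ≤ m`. -/
theorem coF_nonneg {n j m c : ℕ} (hm : 1 ≤ m) (hmj : m ≤ j) (hn : 2 * j + 1 ≤ n) (hc : c ≤ m) :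
    0 ≤ coF n j m c := by
  rw [coF_eq hm hmj hn hc]
  apply add_nonneg (coDel_nonneg n j m)
  apply div_nonneg (mul_nonneg (coV_nonneg n j m c) (coQ_nonneg hmj hn))
  positivity

/-- `f_c ≤ 1` for `c < m`. -/
theorem coF_le_one {n j m c : ℕ} (hm : 1 ≤ m) (hmj : m ≤ j) (hn : 2 * j + 1 ≤ n) (hc : c < m) :
    coF n j m c ≤ 1 := by
  unfold coF
  have := (coSeq_nonneg hm hmj hn hc).1
  have hr : (0 : ℚ) ≤ ((n - j : ℕ) : ℚ) := by positivity
  nlinarith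

/-- `g_c ≥ 0` for `c < m`. -/
theorem coG_nonneg {n j m c : ℕ} (hm : 1 ≤ m) (hmj : m ≤ j) (hn : 2 * j + 1 ≤ n) (hc : c < m) :
    0 ≤ coG n j m c := by
  have h := coF_row hm hmj hn hc
  have hf := coF_nonneg hm hmj hn hc.le
  have hmc : (0 : ℚ) < (m : ℚ) - c := by
    have : (c : ℚ) + 1 ≤ m := by exact_mod_cast hc
    linarith
  have hcoef : (0 : ℚ) ≤ (n : ℚ) - j - m + c := by
    have : (j : ℚ) + m ≤ n := by exact_mod_cast (show j + m ≤ n by omega)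
    have : (0 : ℚ) ≤ c := by positivity
    linarith
  have hprod : 0 ≤ ((m : ℚ) - c) * coG n j m c := by
    rw [h]
    exact mul_nonneg hcoef hf
  by_contra hneg
  have : ((m : ℚ) - c) * coG n j m c < 0 := mul_neg_of_pos_of_neg hmc (not_le.1 hneg)
  linarith

/-- `2^m·C(n − m, j − m) ≤ C(n, j)` for `m ≤ j` and `2j + 1 ≤ n`. -/
theorem two_pow_mul_choose_le {n j : ℕ} (hn : 2 * j + 1 ≤ n) :
    ∀ m, m ≤ j → 2 ^ m * (n - m).choose (j - m) ≤ n.choose j := by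
  intro m
  induction m with
  | zero => intro _; simp
  | succ m ih =>
    intro hmj
    have ih' := ih (by omega)
    -- `C(n − m, j − m) ≥ 2·C(n − m − 1, j − m − 1)`
    have hstep : 2 * (n - (m + 1)).choose (j - (m + 1)) ≤ (n - m).choose (j - m) := by
      have h := Nat.add_one_mul_choose_eq (n - (m + 1)) (j - (m + 1))
      have e1 : n - (m + 1) + 1 = n - m := by omega
      have e2 : j - (m + 1) + 1 = j - m := by omega
      rw [e1, e2] at h
      -- `(n − m)·C(n−m−1, j−m−1) = C(n−m, j−m)·(j−m)` and `n − m ≥ 2(j − m)`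
      have h2 : 2 * (j - m) ≤ n - m := by omega
      have hpos : 0 < j - m := by omega
      have : 2 * (j - m) * (n - (m + 1)).choose (j - (m + 1)) ≤ (n - m).choose (j - m) * (j - m) := by
        calc 2 * (j - m) * (n - (m + 1)).choose (j - (m + 1))
            ≤ (n - m) * (n - (m + 1)).choose (j - (m + 1)) := Nat.mul_le_mul_right _ h2
          _ = (n - m).choose (j - m) * (j - m) := h
      have : (2 * (n - (m + 1)).choose (j - (m + 1))) * (j - m) ≤ (n - m).choose (j - m) * (j - m) := by
        calc (2 * (n - (m + 1)).choose (j - (m + 1))) * (j - m)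
            = 2 * (j - m) * (n - (m + 1)).choose (j - (m + 1)) := by ring
          _ ≤ (n - m).choose (j - m) * (j - m) := this
      exact Nat.le_of_mul_le_mul_right this hpos
    calc 2 ^ (m + 1) * (n - (m + 1)).choose (j - (m + 1))
        = 2 ^ m * (2 * (n - (m + 1)).choose (j - (m + 1))) := by ring
      _ ≤ 2 ^ m * (n - m).choose (j - m) := Nat.mul_le_mul_left _ hstep
      _ ≤ n.choose j := ih'

/-- `δ·2^m ≤ 1`. -/
theorem coDel_mul_two_pow_le {n j m : ℕ} (hmj : m ≤ j) (hn : 2 * j + 1 ≤ n) : coDel n j m * 2 ^ m ≤ 1 := by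
  have hC : (0 : ℚ) < ((n.choose j : ℕ) : ℚ) := by exact_mod_cast Nat.choose_pos (by omega)
  have h := two_pow_mul_choose_le hn m hmj
  have hq : (2 : ℚ) ^ m * ((n - m).choose (j - m) : ℕ) ≤ ((n.choose j : ℕ) : ℚ) := by exact_mod_cast h
  unfold coDel
  rw [div_mul_eq_mul_div, div_le_one hC]
  linarith

/-- `f_{m−1} ≤ (j + 1 − m)/(m·(n − j − 1))`. -/
theorem coF_top_le {n j m : ℕ} (hm : 1 ≤ m) (hmj : m ≤ j) (hn : 2 * j + 1 ≤ n) :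
    coF n j m (m - 1) ≤ ((j + 1 - m : ℕ) : ℚ) / ((m : ℚ) * ((n - j - 1 : ℕ) : ℚ)) := by
  have hrow := coF_row hm hmj hn (c := m - 1) (by omega)
  have htop := coF_top hm hmj hn
  have hδ := coDel_nonneg n j m
  have hmq : (0 : ℚ) < (m : ℚ) := by exact_mod_cast hm
  have hr1 : (0 : ℚ) < ((n - j - 1 : ℕ) : ℚ) := by
    have : 1 ≤ n - j - 1 := by omega
    exact_mod_cast this
  have e1 : ((m : ℚ) - ((m - 1 : ℕ) : ℚ)) = 1 := by
    rw [Nat.cast_sub hm]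
    push_cast
    ring
  have e2 : ((n : ℚ) - j - m + ((m - 1 : ℕ) : ℚ)) = ((n - j - 1 : ℕ) : ℚ) := by
    rw [Nat.cast_sub hm]
    push_cast [show n - j - 1 = n - (j + 1) by omega, Nat.cast_sub (show j + 1 ≤ n by omega)]
    ring
  rw [e1, e2, one_mul] at hrow
  have e3 : ((j + 1 - m : ℕ) : ℚ) = (j : ℚ) + 1 - m := by
    rw [Nat.cast_sub (by omega)]
    push_cast
    ring
  rw [e3, le_div_iff₀ (mul_pos hmq hr1)]
  -- `m·g_{m−1} ≤ j + 1 − m` and `g_{m−1} = (n − j − 1)·f_{m−1}`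
  have hg : (m : ℚ) * coG n j m (m - 1) ≤ (j : ℚ) + 1 - m := by nlinarith
  rw [hrow] at hg
  linarith

/-- `V_c·Q_c/(C(m, c)·C(n, j)) ≤ 1/C(m, c)` for `c ≤ m`. -/
theorem coT_le_inv_choose {n j m c : ℕ} (hmj : m ≤ j) (hn : 2 * j + 1 ≤ n) (hc : c ≤ m) :
    coV n j m c * coQ n j m c / (((m.choose c : ℕ) : ℚ) * ((n.choose j : ℕ) : ℚ)) ≤ 1 / ((m.choose c : ℕ) : ℚ) := by
  have hC : (0 : ℚ) < ((n.choose j : ℕ) : ℚ) := by exact_mod_cast Nat.choose_pos (by omega)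
  have hB : (0 : ℚ) < ((m.choose c : ℕ) : ℚ) := by exact_mod_cast Nat.choose_pos hc
  have hV : coV n j m c ≤ ((n.choose j : ℕ) : ℚ) := by
    calc coV n j m c ≤ coP n j m := coV_le_coP hmj (by omega) hc
      _ ≤ ((n.choose j : ℕ) : ℚ) := by
          unfold coP
          have : (0 : ℚ) ≤ ((n - m).choose (j - m) : ℕ) := by positivity
          linarith
  have hQ := coQ_le_one (c := c) hmj hn
  have hQ0 := coQ_nonneg (c := c) hmj hn
  have hV0 := coV_nonneg n j m c
  rw [div_le_div_iff₀ (mul_pos hB hC) hB]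
  have : coV n j m c * coQ n j m c ≤ ((n.choose j : ℕ) : ℚ) := by
    calc coV n j m c * coQ n j m c ≤ ((n.choose j : ℕ) : ℚ) * 1 := mul_le_mul hV hQ hQ0 hC.le
      _ = ((n.choose j : ℕ) : ℚ) := by ring
  nlinarith

/-- `f_c ≤ δ + 1/C(m, c)` for `c ≤ m`. -/
theorem coF_le_coDel_add {n j m c : ℕ} (hm : 1 ≤ m) (hmj : m ≤ j) (hn : 2 * j + 1 ≤ n) (hc : c ≤ m) :
    coF n j m c ≤ coDel n j m + 1 / ((m.choose c : ℕ) : ℚ) := by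
  rw [coF_eq hm hmj hn hc]
  linarith [coT_le_inv_choose hmj hn hc]

/-- **`f_c ≤ 1/2`** for every `c < m` when `2 ≤ m ≤ j` and `2j + 1 ≤ n`. -/
theorem coF_le_half {n j m c : ℕ} (hm : 2 ≤ m) (hmj : m ≤ j) (hn : 2 * j + 1 ≤ n) (hc : c < m) :
    coF n j m c ≤ 1 / 2 := by
  have hδ := coDel_mul_two_pow_le hmj hn
  have hδ0 := coDel_nonneg n j m
  rcases Nat.eq_or_lt_of_le (Nat.le_of_lt_succ (show c < (m - 1) + 1 by omega)) with htop | hlt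
  · -- `c = m − 1`
    subst htop
    have h := coF_top_le (by omega) hmj hn
    refine h.trans ?_
    have hmq : (2 : ℚ) ≤ m := by exact_mod_cast hm
    have hr1 : (j : ℚ) ≤ ((n - j - 1 : ℕ) : ℚ) := by exact_mod_cast (show j ≤ n - j - 1 by omega)
    have hL : ((j + 1 - m : ℕ) : ℚ) = (j : ℚ) + 1 - m := by
      rw [Nat.cast_sub (by omega)]
      push_cast
      ring
    have hj : (0 : ℚ) < (j : ℚ) := by exact_mod_cast (show 0 < j by omega)
    have hr1' : (0 : ℚ) < ((n - j - 1 : ℕ) : ℚ) := by linarith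
    rw [hL, div_le_iff₀ (mul_pos (by linarith) hr1')]
    nlinarith
  · rcases Nat.eq_zero_or_pos c with h0 | hpos
    · -- `c = 0`: `f_0 = δ ≤ 1/4`
      subst h0
      rw [coF_zero (m := m) hn]
      have h4 : (4 : ℚ) ≤ 2 ^ m := by
        calc (4 : ℚ) = 2 ^ 2 := by norm_num
          _ ≤ 2 ^ m := pow_le_pow_right₀ (by norm_num) hm
      nlinarith
    · -- `1 ≤ c ≤ m − 2`: `δ ≤ 1/8`, `1/C(m, c) ≤ 1/m ≤ 1/3`
      have hm3 : 3 ≤ m := by omega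
      have h8 : (8 : ℚ) ≤ 2 ^ m := by
        calc (8 : ℚ) = 2 ^ 3 := by norm_num
          _ ≤ 2 ^ m := pow_le_pow_right₀ (by norm_num) hm3
      have hδ8 : coDel n j m ≤ 1 / 8 := by nlinarith
      have hB : (m : ℚ) ≤ ((m.choose c : ℕ) : ℚ) := by exact_mod_cast le_choose_of_one_le_of_lt hpos hc
      have hm3q : (3 : ℚ) ≤ m := by exact_mod_cast hm3
      have hinv : 1 / ((m.choose c : ℕ) : ℚ) ≤ 1 / 3 := by
        rw [div_le_div_iff₀ (by linarith) (by norm_num)]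
        linarith
      have := coF_le_coDel_add (by omega) hmj hn hc.le
      linarith

end PercRepro.PuncturedLYM
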